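import Literature.NumberTheory.Automorphic.BockleHuiIrreducibleGL3AnalyticProofs
import Literature.NumberTheory.Automorphic.PairLFunctionPolesRepDataHolds
import Literature.NumberTheory.Automorphic.PairLFunctionMeromorphicContinuationNeConjProofs
import HarnessLib

/-!
# Böckle–Hui 2025, Theorem 1.2 — the weight condition of §3.2.1 discharged, and the central
# character / Jacquet–Shalika (2.1) inputs fed from theorems of the tree (proofs only)

Topic `NumberTheory/Automorphic`; namespace `Literature.NumberTheory.Automorphic`.  Fourth PROOFS
file (theorems only: no definition, no named fact, no `sorry`) for the named fact
`isIrreducible_galoisRep_gl3_totallyReal` (Böckle–Hui, Math. Ann. 393 (2025), Thm. 1.2, arXiv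
p. 13), after `BockleHuiIrreducibleGL3Proofs` (skeleton of §3.2.1),
`BockleHuiIrreducibleGL3ReductionProofs` (reduction to statements about `π` alone) and
`BockleHuiIrreducibleGL3AnalyticProofs` (the analytic case `hB` from Jacquet–Shalika (2.2), the
contragredient, a central character at Satake level `hcent` and a weight condition `hpin`; (2.1) and
the pole of `ζ_K^S` at `s = 1` being theorems of the tree).

This file removes two of the inputs of `isIrreducible_galoisRep_gl3_totallyReal_of_JS`:

* `hcent` — every cuspidal Borel–Jacquet datum on `GL_n(𝔸_K)` has a central character at Satake
  level, `Ω(ϖ_v) = ∏ t_{π,v}` a.e. (`centralCharacter_satake_of_cuspidal`), because the unitary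
  normalisation `t_{π,v} = q_v^{s} t_{P,v}`, `P ≤ L²_cusp` (Borel–Jacquet 1979, 5.7: "we may assume
  `π` unitary") is now unconditional (`CuspidalAutomorphicRepData.exists_normalisation_L2`, from
  `…exists_satake_eq_cpow_mul_L2_of_realisation` and the theorems
  `AutomorphicRepsGL.cuspidal_closure_exists_mem_l2OfForms_holds`,
  `AutomorphicRepsGL.stable_cuspidal_eq_sSup_irreducible_holds`);
* `hpin` — **the weight condition is PROVED** (`norm_prod_satake_eq_norm_cube_of_JS`): if `μ` is a
  Hecke character with `μ(ϖ_v) ∈ t_{π,v}` at almost every `v` for a cuspidal `π` on `GL_3(𝔸_K)`,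
  then `‖∏ t_{π,v}‖ = ‖μ(ϖ_v)‖³` a.e.  This is the bookkeeping implicit in the printed "the
  right-hand side of (L-eq) at `s = 1` belongs to `ℂ` … `L^{S'}(Alt²(π) ⊗ ψ₁, s)` is non-zero at
  `s = 1` by Shahidi [Sh97]" (BH §3.2.1, p. 13), and it is proved here by the same (L-eq), run OFF
  the unitary axis.  Write `|μ| = ‖·‖^{σ_μ}`, `|ω_π| = ‖·‖^{σ_Ω}` and normalise `π₀ = π ⊗ ‖·‖^{-σ_Ω/3}`
  (unitary), `θ = μ‖·‖^{-σ_Ω/3}` (so `θ(ϖ_v) ∈ t_{π₀,v}`, `|θ(ϖ_v)| = q_v^{-d}`, `d = σ_μ - σ_Ω/3`).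
  If `d < 0` the three twists in
  `L^S(s, π₀ × θ⁻¹) L^S(s, ν) = ζ^S(s) L^S(s, π₀^∨ ⊗ κ)` (`κ = ω_{π₀} θ^{-2}`, `ν = κ θ⁻¹`) have
  moduli `q_v^{d}`, `q_v^{3d}`, `q_v^{2d}`, all `< 1`, so the identity reads
  `A(s - d) N(s - 3d) = ζ^S(s) C(s - 2d)` with `A`, `N`, `C` partial Rankin–Selberg `L`-functions of
  UNITARY cuspidal pairs, convergent, continuous and non-zero on `Re s > 1` (Jacquet–Shalika I,
  Thm. 5.3: `differentiableOn_partialPairL_of_isSatakeFamilyOf`, `partialPairL_ne_zero_of_isSatakeFamilyOf`,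
  transported to Borel–Jacquet data by the unitary normalisation); letting `s → 1⁺` the left side
  stays finite while `ζ^S(s) C(s - 2d) → ∞` — contradiction (`false_of_JS_of_eulerIdentity_of_shift`,
  `false_of_large_heckeCharacter_mem_satake`).  If `d > 0` the same argument applies to the dual data
  (`π₀^∨`, `θ⁻¹`).  Hence `d = 0`, which is `hpin`.  No named fact enters here: (2.1) is the theorem
  `JacquetShalika1981_multipliable_partialPairL_repData_holds` and the pole of `ζ_F^S` at `s = 1` is
  Hecke's theorem `tendsto_sub_one_mul_partialPairL_one_one`; the boundary case `d = 0` is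
  `prod_satake_eq_cube_of_JS` of the previous file ((2.2)).

Result (`isIrreducible_galoisRep_gl3_totallyReal_of_JS'`): Theorem 1.2 now follows from the named
facts `exists_heckeCharacter_of_weaklyDivides` (BH Thm. 1.1), Jacquet–Shalika (2.2) for
Borel–Jacquet data (or its `L²` leaves, `isIrreducible_galoisRep_gl3_totallyReal_of_L2_leaves`), the
contragredient datum `CuspidalAutomorphicRepData.exists_contragredient_satake`, and the two printed
inputs without carrier in the tree (`hCar`: C-arithmeticity, Clozel 3.13 + BG14; `hHui`: [Hu23a]).

## References

* G. Böckle, C.-Y. Hui, *Weak abelian direct summands and irreducibility of Galois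
  representations*, Math. Ann. 393 (2025), §3.2.1 (arXiv:2404.08954, p. 13). [BockleHui2025]
* J. Arthur, L. Clozel, *Simple algebras, base change, and the advanced theory of the trace
  formula*, Ann. of Math. Stud. 120 (1989), Ch. 3 §2, (2.1)–(2.3), p. 171. [ArthurClozelAMS120]
* H. Jacquet, J. A. Shalika, *On Euler products and the classification of automorphic
  representations I*, Amer. J. Math. 103 (1981), Thm. (5.3). [JacquetShalikaAJM1981]
* A. Borel, H. Jacquet, *Automorphic forms and automorphic representations*, PSPM 33.1 (1979),
  4.6, 5.7. [BorelJacquetCorvallis1979]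
-/

noncomputable section

open scoped MatrixGroups Topology Classical NumberField
open NumberField IsDedekindDomain MeasureTheory Filter Polynomial

namespace Literature.NumberTheory.Automorphic

open AdelicGroupData
open Literature.NumberTheory.GaloisRepresentations (HeckeCharacter ideleGroup localUnits)

/-! ### Bookkeeping on Hecke characters at uniformizers -/

section Bookkeeping

variable {F : Type} [Field F] [NumberField F]

/-- `χ(ϖ_v)` is the value of `χ` at the idele `(…, 1, ϖ_v, 1, …)`. [folklore] -/
private theorem w_vAU_apply (χ : HeckeCharacter F) (v : HeightOneSpectrum (𝓞 F)) :
    χ.valueAtUniformizer v =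
      ((χ (localUnits v (GaloisRepresentations.HeckeCharacter.uniformizer F v)) : ℂˣ) : ℂ) := by
  simp only [GaloisRepresentations.HeckeCharacter.valueAtUniformizer,
    GaloisRepresentations.HeckeCharacter.localComponent_apply]

/-- `(χ₁ χ₂)(ϖ_v) = χ₁(ϖ_v) χ₂(ϖ_v)`. [folklore] -/
private theorem w_vAU_mul (χ₁ χ₂ : HeckeCharacter F) (v : HeightOneSpectrum (𝓞 F)) :
    (χ₁ * χ₂).valueAtUniformizer v = χ₁.valueAtUniformizer v * χ₂.valueAtUniformizer v := by
  simp only [w_vAU_apply, GaloisRepresentations.HeckeCharacter.mul_apply, Units.val_mul]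

/-- `χ⁻¹(ϖ_v) = χ(ϖ_v)⁻¹`. [folklore] -/
private theorem w_vAU_inv (χ : HeckeCharacter F) (v : HeightOneSpectrum (𝓞 F)) :
    χ⁻¹.valueAtUniformizer v = (χ.valueAtUniformizer v)⁻¹ := by
  simp only [w_vAU_apply, GaloisRepresentations.HeckeCharacter.inv_apply, Units.val_inv_eq_inv_val]

/-- `χ(ϖ_v) ≠ 0`. [folklore] -/
private theorem w_vAU_ne_zero (χ : HeckeCharacter F) (v : HeightOneSpectrum (𝓞 F)) :
    χ.valueAtUniformizer v ≠ 0 := by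
  rw [w_vAU_apply]
  exact Units.ne_zero _

/-- **`|χ(ϖ_v)| = q_v^{-σ}` when `|χ| = ‖·‖^{σ}` on ideles** (`‖ϖ_v‖ = q_v⁻¹`), computed through the
norm-power character `‖·‖^{σ}` (`HeckeCharacter.valueAtUniformizer_of_cpow`). [cite: TateThesis1967, §4.3] -/
private theorem w_norm_vAU_eq_rpow_neg {χ : HeckeCharacter F} {σ : ℝ}
    (hσ : ∀ x : ideleGroup F, ‖((χ x : ℂˣ) : ℂ)‖ = GaloisRepresentations.ideleNorm x ^ σ)
    (v : HeightOneSpectrum (𝓞 F)) :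
    ‖χ.valueAtUniformizer v‖ = (v.residueCard : ℝ) ^ (-σ) := by
  obtain ⟨lam, hlam⟩ := exists_heckeCharacter_ideleNorm_cpow F (σ : ℂ)
  have hχlam : ∀ x : ideleGroup F, ‖((χ x : ℂˣ) : ℂ)‖ = ‖((lam x : ℂˣ) : ℂ)‖ := fun x => by
    rw [hσ x, hlam x,
      Complex.norm_cpow_eq_rpow_re_of_pos (GaloisRepresentations.HeckeCharacter.ideleNorm_pos' F x),
      Complex.ofReal_re]
  have h1 : ‖χ.valueAtUniformizer v‖ = ‖lam.valueAtUniformizer v‖ := by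
    rw [w_vAU_apply, w_vAU_apply]
    exact hχlam _
  rw [h1, HeckeCharacter.valueAtUniformizer_of_cpow hlam v, norm_inv,
    Complex.norm_natCast_cpow_of_pos (Nat.zero_lt_of_lt v.one_lt_residueCard), Complex.ofReal_re,
    Real.rpow_neg (Nat.cast_nonneg _)]

/-- `‖(q_v : ℂ) ^ z‖ = q_v ^ {re z}`. [folklore] -/
private theorem w_norm_qpow (v : HeightOneSpectrum (𝓞 F)) (z : ℂ) :
    ‖(v.residueCard : ℂ) ^ z‖ = (v.residueCard : ℝ) ^ z.re :=
  Complex.norm_natCast_cpow_of_pos (Nat.zero_lt_of_lt v.one_lt_residueCard) z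

/-- `(q_v : ℂ) ^ z ≠ 0`. [folklore] -/
private theorem w_qpow_ne_zero (v : HeightOneSpectrum (𝓞 F)) (z : ℂ) : (v.residueCard : ℂ) ^ z ≠ 0 := by
  have hq : (v.residueCard : ℂ) ≠ 0 :=
    Nat.cast_ne_zero.2 (ne_of_gt (lt_trans zero_lt_one v.one_lt_residueCard))
  exact fun h => hq ((Complex.cpow_eq_zero_iff _ _).1 h).1

/-- From `((q : ℝ)^x)^n = 1` with `q > 1`, `n ≠ 0`: `x = 0`. [folklore] -/
private theorem w_rpow_pow_eq_one {q n : ℕ} (hq : 1 < q) (hn : n ≠ 0) {x : ℝ}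
    (h : ((q : ℝ) ^ x) ^ n = 1) : x = 0 := by
  have hq0 : (0 : ℝ) < q := by exact_mod_cast (lt_trans zero_lt_one hq)
  have hpos : (0 : ℝ) < (q : ℝ) ^ x := Real.rpow_pos_of_pos hq0 _
  have h1q : (q : ℝ) ^ x = 1 := (pow_eq_one_iff_of_nonneg hpos.le hn).mp h
  have hq' : (1 : ℝ) < q := by exact_mod_cast hq
  rcases lt_trichotomy x 0 with hlt | heq | hgt
  · exact absurd h1q (ne_of_lt (Real.rpow_lt_one_of_one_lt_of_neg hq' hlt))
  · exact heq
  · exact absurd h1q (ne_of_gt (Real.one_lt_rpow hq' hgt))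

end Bookkeeping

/-! ### Unitary normalisation and central characters of cuspidal Borel–Jacquet data
(now unconditional) -/

section Normalisation

variable {n : ℕ} {K : Type} [Field K] [NumberField K]

/-- **"We may assume `π` unitary" (Borel–Jacquet 1979, 5.7), unconditionally.**  Every cuspidal
Borel–Jacquet datum `π` on `GL_n(𝔸_K)` (`n ≥ 1`) has a unitary normalisation: a cuspidal
`P ≤ L²_cusp(GL_n(K) A_G \ GL_n(𝔸_K))` with Satake family `α_P` off a finite `S` and `s ∈ ℂ` such
that the Satake parameters of `π` at `w ∉ S` are exactly `q_w^{s} α_P(w)`.  This is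
`CuspidalAutomorphicRepData.exists_satake_eq_cpow_mul_L2_of_realisation` fed with the theorems
`AutomorphicRepsGL.cuspidal_closure_exists_mem_l2OfForms_holds` (through
`AutomorphicRepsGL.exists_le_formsOfL2_of_W'_eq_bot_of_closure_exists_mem`) and
`AutomorphicRepsGL.stable_cuspidal_eq_sSup_irreducible_holds` (through
`CuspidalAutomorphicRepData.exists_clean_hasSatakeParamAt_of_sSup_irreducible`).
[cite: BorelJacquetCorvallis1979, 5.7] -/
theorem CuspidalAutomorphicRepData.exists_normalisation_L2 (hK : isCompact_glFiniteIntegralLevel n K)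
    [NeZero n] (μ : Measure (gl n K).automorphicQuotient) [(gl n K).IsAutomorphicMeasure μ]
    (π : CuspidalAutomorphicRepData n K hK) :
    ∃ (s : ℂ) (P : CuspidalAutomorphicRepGL n K μ) (S : Set (HeightOneSpectrum (𝓞 K)))
      (αP : SatakeFamily K), S.Finite ∧ IsSatakeFamilyOf P S αP ∧
      ∀ w ∉ S, ∀ β : Multiset ℂ,
        π.1.HasSatakeParamAt w β ↔ β = (αP w).map (((w.residueCard : ℂ) ^ s) * ·) :=
  CuspidalAutomorphicRepData.exists_satake_eq_cpow_mul_L2_of_realisation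
    (fun hK μ _ => AutomorphicRepsGL.exists_le_formsOfL2_of_W'_eq_bot_of_closure_exists_mem hK μ
      AutomorphicRepsGL.cuspidal_closure_exists_mem_l2OfForms_holds)
    (fun _ _ π => CuspidalAutomorphicRepData.exists_clean_hasSatakeParamAt_of_sSup_irreducible
      AutomorphicRepsGL.stable_cuspidal_eq_sSup_irreducible_holds π) hK μ π

/-- **The central character of a cuspidal Borel–Jacquet datum at Satake level, unconditionally**
(the input `hcent` of `isIrreducible_galoisRep_gl3_totallyReal_of_JS`): for every cuspidal `π` on
`GL_n(𝔸_K)` (`n ≥ 1`) there is a Hecke character `Ω` with `Ω(ϖ_v) = ∏ t_{π,v}` for every Satake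
parameter `t_{π,v}` of `π` at almost every `v` — `exists_heckeCharacter_prod_satake_of_normalisation`
on the unitary normalisation `CuspidalAutomorphicRepData.exists_normalisation_L2` (with the automorphic
measure of `AdelicGroupData.exists_isAutomorphicMeasure_gl_holds`).  Borel–Jacquet 1979, §4.6, 5.7
(`ω_π(ϖ_v) = det t_{π,v}`). [cite: BorelJacquetCorvallis1979, §4.6 and 5.7] -/
theorem centralCharacter_satake_of_cuspidal [NeZero n] {hK : isCompact_glFiniteIntegralLevel n K}
    (π : CuspidalAutomorphicRepData n K hK) :
    ∃ Ω : HeckeCharacter K, ∀ᶠ v : HeightOneSpectrum (𝓞 K) in cofinite, ∀ α : Multiset ℂ,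
      π.1.HasSatakeParamAt v α → Ω.valueAtUniformizer v = α.prod := by
  obtain ⟨μ, hμ⟩ := AdelicGroupData.exists_isAutomorphicMeasure_gl_holds n K
  haveI := hμ
  obtain ⟨s, P, S, A, hS, hAP, hiff⟩ := CuspidalAutomorphicRepData.exists_normalisation_L2 hK μ π
  exact exists_heckeCharacter_prod_satake_of_normalisation π hS hAP hiff

end Normalisation

/-! ### Continuity and non-vanishing of `L^S(s, π ⊗ σ)` at interior points of `Re s > 1`, for
Borel–Jacquet data -/

section Interior

variable {n m : ℕ} {F : Type} [Field F] [NumberField F]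

/-- **Jacquet–Shalika I, Thm. (5.3), for Borel–Jacquet data: `L^S(s, π ⊗ σ)` is continuous and
non-zero at every `s` with `Re s > 1`.**  For cuspidal `π` on `GL_n(𝔸_F)`, `σ` on `GL_m(𝔸_F)`
(`n, m ≥ 1`, Borel–Jacquet data) there is a finite `S₀` such that for every finite `S ⊇ S₀` and all
UNITARY Satake families `α`, `β` of `π`, `σ` off `S` (`|det t_w| = 1`), `partialPairL S α β` is
continuous and non-zero at every point of the open half-plane `Re s > 1` ("the Euler product is
absolutely convergent … in `Re s > 1`" and "does not vanish" there).  Proof: the unitary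
normalisations `α = q^{a} α_P`, `β = q^{b} β_{P'}` (`CuspidalAutomorphicRepData.exists_normalisation_L2`)
have `Re a = Re b = 0` by unitarity on both sides (`HasSatakeParameterAt.norm_prod_eq_one`), and
`L^S(s, α ⊗ β) = L^S(s - a - b, α_P ⊗ β_{P'})` (`partialPairL_eq_of_shift`), holomorphic and non-zero on
`Re s > 1` (`differentiableOn_partialPairL_of_isSatakeFamilyOf`, `partialPairL_ne_zero_of_isSatakeFamilyOf`).
[cite: JacquetShalikaAJM1981, Thm. (5.3)] -/
theorem continuousAt_and_ne_zero_partialPairL_repData [NeZero n] [NeZero m]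
    {hF : isCompact_glFiniteIntegralLevel n F} {hF' : isCompact_glFiniteIntegralLevel m F}
    (π : CuspidalAutomorphicRepData n F hF) (π' : CuspidalAutomorphicRepData m F hF') :
    ∃ S₀ : Set (HeightOneSpectrum (𝓞 F)), S₀.Finite ∧
      ∀ {S : Set (HeightOneSpectrum (𝓞 F))} (_hS : S.Finite) (_hS₀ : S₀ ⊆ S)
        {α β : SatakeFamily F} (_hα : ∀ w ∉ S, π.1.HasSatakeParamAt w (α w))
        (_hβ : ∀ w ∉ S, π'.1.HasSatakeParamAt w (β w))
        (_hu : ∀ w ∉ S, ‖(α w).prod‖ = 1) (_hu' : ∀ w ∉ S, ‖(β w).prod‖ = 1)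
        {s : ℂ} (_hs : 1 < s.re),
        ContinuousAt (partialPairL S α β) s ∧ partialPairL S α β s ≠ 0 := by
  obtain ⟨μn, hμn⟩ := AdelicGroupData.exists_isAutomorphicMeasure_gl_holds n F
  obtain ⟨μm, hμm⟩ := AdelicGroupData.exists_isAutomorphicMeasure_gl_holds m F
  haveI := hμn
  haveI := hμm
  obtain ⟨a, P, S₁, A, hS₁, hA, hiffA⟩ := CuspidalAutomorphicRepData.exists_normalisation_L2 hF μn π
  obtain ⟨b, P', S₂, B, hS₂, hB, hiffB⟩ :=
    CuspidalAutomorphicRepData.exists_normalisation_L2 hF' μm π'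
  refine ⟨S₁ ∪ S₂, hS₁.union hS₂, ?_⟩
  intro S hS hS₀ α β hα hβ hu hu' s hs
  have hS₁S : S₁ ⊆ S := fun x hx => hS₀ (Or.inl hx)
  have hS₂S : S₂ ⊆ S := fun x hx => hS₀ (Or.inr hx)
  have h1 : ∀ w ∉ S, α w = (A w).map (((w.residueCard : ℂ) ^ a) * ·) := fun w hw =>
    (hiffA w (fun h => hw (hS₁S h)) (α w)).1 (hα w hw)
  have h2 : ∀ w ∉ S, β w = (B w).map (((w.residueCard : ℂ) ^ b) * ·) := fun w hw =>
    (hiffB w (fun h => hw (hS₂S h)) (β w)).1 (hβ w hw)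
  have hA' : IsSatakeFamilyOf P S A := hA.mono hS₁S
  have hB' : IsSatakeFamilyOf P' S B := hB.mono hS₂S
  by_cases hex : ∃ w, w ∉ S
  · obtain ⟨w₀, hw₀⟩ := hex
    -- the shifts are unitary: `re a = re b = 0`
    have ha : a.re = 0 := by
      obtain ⟨𝔫, -, -, ϖ, hSat⟩ := hA' w₀ hw₀
      have h := hu w₀ hw₀
      rw [h1 w₀ hw₀, prod_map_const_mul_eq, hSat.card_eq, norm_mul, norm_pow, hSat.norm_prod_eq_one,
        mul_one, w_norm_qpow] at h
      exact w_rpow_pow_eq_one w₀.one_lt_residueCard (NeZero.ne n) h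
    have hb : b.re = 0 := by
      obtain ⟨𝔫, -, -, ϖ, hSat⟩ := hB' w₀ hw₀
      have h := hu' w₀ hw₀
      rw [h2 w₀ hw₀, prod_map_const_mul_eq, hSat.card_eq, norm_mul, norm_pow, hSat.norm_prod_eq_one,
        mul_one, w_norm_qpow] at h
      exact w_rpow_pow_eq_one w₀.one_lt_residueCard (NeZero.ne m) h
    have hshift : partialPairL S α β = fun s => partialPairL S A B (s - (a + b)) :=
      partialPairL_eq_of_shift h1 h2
    have hs' : 1 < (s - (a + b)).re := by
      simp only [Complex.sub_re, Complex.add_re, ha, hb, add_zero, sub_zero]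
      exact hs
    have hopen : IsOpen {s : ℂ | 1 < s.re} := isOpen_lt continuous_const Complex.continuous_re
    have hD := differentiableOn_partialPairL_of_isSatakeFamilyOf P P' hA' hB'
    refine ⟨?_, ?_⟩
    · rw [hshift]
      have hf : ContinuousAt (fun z : ℂ => z - (a + b)) s :=
        (continuous_id.sub continuous_const).continuousAt
      exact ContinuousAt.comp (g := partialPairL S A B)
        (hD.differentiableAt (hopen.mem_nhds hs')).continuousAt hf
    · rw [hshift]
      exact partialPairL_ne_zero_of_isSatakeFamilyOf P P' hA' hB' hs'
  · -- no finite place outside `S`: the Euler products are empty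
    haveI hE : IsEmpty {v : HeightOneSpectrum (𝓞 F) // v ∉ S} := ⟨fun v => hex ⟨v.1, v.2⟩⟩
    have hconst : partialPairL S α β = fun _ => 1 := by
      funext z
      unfold partialPairL
      exact tprod_empty
    rw [hconst]
    exact ⟨continuousAt_const, one_ne_zero⟩

end Interior

/-! ### The (L-eq) argument off the unitary axis -/

section OffAxis

variable {F : Type} [Field F] [NumberField F]

/-- Shifting no family: `γ w = q_w^{0} γ w`. [folklore] -/
private theorem w_shift_zero {S : Set (HeightOneSpectrum (𝓞 F))} (γ : SatakeFamily F) :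
    ∀ w ∉ S, γ w = (γ w).map (((w.residueCard : ℂ) ^ (0 : ℂ)) * ·) := fun w _ => by
  simp only [Complex.cpow_zero, one_mul, Multiset.map_id']

/-- **(L-eq) off the unitary axis is contradictory** (unconditionally: (2.1) and the pole of `ζ_F^S`
are theorems of the tree).  Let `τ₀`, `τ₁`, `τν` be cuspidal data on `GL(1)` and
`P`, `Q` on `GL(3)` over `F` whose Satake families off a finite `T` are `{1}`, `u₁`, `uν`, `β`, `B₁`,
all UNITARY (`|det t_w| = 1`), let `t > 0`, and suppose the Euler factors satisfy
`P(β, q^{-t} u₁) P(q^{-3t} uν, 1) = P(1, 1) P(q^{-2t} B₁, 1)` off `T` — the identity (L-eq)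
`L^S(s, π₀ × θ⁻¹) L^S(s, ν) = ζ_F^S(s) L^S(s, π₀^∨ ⊗ κ)` of BH §3.2.1 in which the twisting characters
`θ⁻¹`, `ν`, `κ` have moduli `q_v^{-t}`, `q_v^{-3t}`, `q_v^{-2t}` at `ϖ_v`.  Then `False`: on `Re s > 1`
the identity reads `A(s + t) N(s + 3t) = ζ_F^S(s) C(s + 2t)` with `A = L^S(·, β ⊗ u₁)`,
`N = L^S(·, uν)`, `C = L^S(·, B₁)` (`partialPairL_eq_of_shift`); as `s → 1`, `Re s > 1`, the left side
tends to the finite `A(1 + t) N(1 + 3t)` and `C(s + 2t) → C(1 + 2t) ≠ 0`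
(`continuousAt_and_ne_zero_partialPairL_repData`), while `(s - 1) ζ_F^S(s) → c₀ ≠ 0` (Hecke;
`tendsto_sub_one_mul_partialPairL_one_one`), so `false_of_pole_times_nonzero_eq_finite` applies.  This is the printed "the right-hand side of (L-eq)
at `s = 1` belongs to `ℂ` … On the other hand, `L^{S'}(1, s)` has a simple pole at `s = 1` and
`L^{S'}(Alt²(π) ⊗ ψ₁, s)` is non-zero at `s = 1`", in the region of absolute convergence.
[cite: BockleHui2025, §3.2.1] [cite: JacquetShalikaAJM1981, Thm. (5.3)] -/
theorem false_of_JS_of_eulerIdentity_of_shift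
    {h1 : isCompact_glFiniteIntegralLevel 1 F} {h3 : isCompact_glFiniteIntegralLevel 3 F}
    (τ₀ τ₁ τν : CuspidalAutomorphicRepData 1 F h1) (P Q : CuspidalAutomorphicRepData 3 F h3)
    (one u₁ uν β B₁ : SatakeFamily F) {T : Set (HeightOneSpectrum (𝓞 F))} (hT : T.Finite)
    (hone : ∀ w, one w = {1})
    (hτ₀ : ∀ w ∉ T, τ₀.1.HasSatakeParamAt w (one w)) (hτ₁ : ∀ w ∉ T, τ₁.1.HasSatakeParamAt w (u₁ w))
    (hτν : ∀ w ∉ T, τν.1.HasSatakeParamAt w (uν w))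
    (hP : ∀ w ∉ T, P.1.HasSatakeParamAt w (β w)) (hQ : ∀ w ∉ T, Q.1.HasSatakeParamAt w (B₁ w))
    (hu₁ : ∀ w ∉ T, ‖(u₁ w).prod‖ = 1) (huν : ∀ w ∉ T, ‖(uν w).prod‖ = 1)
    (huβ : ∀ w ∉ T, ‖(β w).prod‖ = 1) (huB : ∀ w ∉ T, ‖(B₁ w).prod‖ = 1)
    {t : ℝ} (ht : 0 < t)
    (hId : ∀ w ∉ T,
      satakePairPolynomial (β w) ((u₁ w).map (((w.residueCard : ℂ) ^ (((-t : ℝ)) : ℂ)) * ·)) *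
          satakePairPolynomial ((uν w).map (((w.residueCard : ℂ) ^ (((-(3 * t) : ℝ)) : ℂ)) * ·))
            (one w) =
        satakePairPolynomial (one w) (one w) *
          satakePairPolynomial ((B₁ w).map (((w.residueCard : ℂ) ^ (((-(2 * t) : ℝ)) : ℂ)) * ·))
            (one w)) :
    False := by
  haveI : NeZero (3 : ℕ) := ⟨by norm_num⟩
  -- the exceptional sets of the seven analytic inputs
  obtain ⟨S₁, hS₁, hJ1a⟩ :=
    JacquetShalika1981_multipliable_partialPairL_repData_holds 3 1 F h3 h1 (by norm_num) one_pos P τ₁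
  obtain ⟨S₂, hS₂, hJ1b⟩ :=
    JacquetShalika1981_multipliable_partialPairL_repData_holds 1 1 F h1 h1 one_pos one_pos τν τ₀
  obtain ⟨S₃, hS₃, hJ1c⟩ :=
    JacquetShalika1981_multipliable_partialPairL_repData_holds 1 1 F h1 h1 one_pos one_pos τ₀ τ₀
  obtain ⟨S₄, hS₄, hJ1d⟩ :=
    JacquetShalika1981_multipliable_partialPairL_repData_holds 3 1 F h3 h1 (by norm_num) one_pos Q τ₀
  obtain ⟨S₅, hS₅, hIa⟩ := continuousAt_and_ne_zero_partialPairL_repData P τ₁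
  obtain ⟨S₆, hS₆, hIb⟩ := continuousAt_and_ne_zero_partialPairL_repData τν τ₀
  obtain ⟨S₇, hS₇, hIc⟩ := continuousAt_and_ne_zero_partialPairL_repData Q τ₀
  set S : Set (HeightOneSpectrum (𝓞 F)) := T ∪ S₁ ∪ S₂ ∪ S₃ ∪ S₄ ∪ S₅ ∪ S₆ ∪ S₇ with hS_def
  have hS : S.Finite :=
    ((((((hT.union hS₁).union hS₂).union hS₃).union hS₄).union hS₅).union hS₆).union hS₇
  have hTS : ∀ w ∉ S, w ∉ T := fun w hw hwT => hw (by simp [hS_def, hwT])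
  have sub₁ : S₁ ⊆ S := fun x hx => by simp [hS_def, hx]
  have sub₂ : S₂ ⊆ S := fun x hx => by simp [hS_def, hx]
  have sub₃ : S₃ ⊆ S := fun x hx => by simp [hS_def, hx]
  have sub₄ : S₄ ⊆ S := fun x hx => by simp [hS_def, hx]
  have sub₅ : S₅ ⊆ S := fun x hx => by simp [hS_def, hx]
  have sub₆ : S₆ ⊆ S := fun x hx => by simp [hS_def, hx]
  have sub₇ : S₇ ⊆ S := fun x hx => by simp [hS_def, hx]
  -- the hypotheses off `S`
  have hτ₀S : ∀ w ∉ S, τ₀.1.HasSatakeParamAt w (one w) := fun w hw => hτ₀ w (hTS w hw)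
  have hτ₁S : ∀ w ∉ S, τ₁.1.HasSatakeParamAt w (u₁ w) := fun w hw => hτ₁ w (hTS w hw)
  have hτνS : ∀ w ∉ S, τν.1.HasSatakeParamAt w (uν w) := fun w hw => hτν w (hTS w hw)
  have hPS : ∀ w ∉ S, P.1.HasSatakeParamAt w (β w) := fun w hw => hP w (hTS w hw)
  have hQS : ∀ w ∉ S, Q.1.HasSatakeParamAt w (B₁ w) := fun w hw => hQ w (hTS w hw)
  have huone : ∀ w ∉ S, ‖(one w).prod‖ = 1 := fun w _ => by rw [hone]; simp
  have hu₁S : ∀ w ∉ S, ‖(u₁ w).prod‖ = 1 := fun w hw => hu₁ w (hTS w hw)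
  have huνS : ∀ w ∉ S, ‖(uν w).prod‖ = 1 := fun w hw => huν w (hTS w hw)
  have huβS : ∀ w ∉ S, ‖(β w).prod‖ = 1 := fun w hw => huβ w (hTS w hw)
  have huBS : ∀ w ∉ S, ‖(B₁ w).prod‖ = 1 := fun w hw => huB w (hTS w hw)
  -- the shifted families
  set su₁ : SatakeFamily F := fun w => (u₁ w).map (((w.residueCard : ℂ) ^ (((-t : ℝ)) : ℂ)) * ·)
    with hsu₁_def
  set suν : SatakeFamily F :=
    fun w => (uν w).map (((w.residueCard : ℂ) ^ (((-(3 * t) : ℝ)) : ℂ)) * ·) with hsuν_def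
  set sB : SatakeFamily F :=
    fun w => (B₁ w).map (((w.residueCard : ℂ) ^ (((-(2 * t) : ℝ)) : ℂ)) * ·) with hsB_def
  have hsu₁ : ∀ w ∉ S, su₁ w = (u₁ w).map (((w.residueCard : ℂ) ^ (((-t : ℝ)) : ℂ)) * ·) :=
    fun w _ => rfl
  have hsuν : ∀ w ∉ S, suν w = (uν w).map (((w.residueCard : ℂ) ^ (((-(3 * t) : ℝ)) : ℂ)) * ·) :=
    fun w _ => rfl
  have hsB : ∀ w ∉ S, sB w = (B₁ w).map (((w.residueCard : ℂ) ^ (((-(2 * t) : ℝ)) : ℂ)) * ·) :=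
    fun w _ => rfl
  -- the Euler factors and partial `L`-functions of the shifted pairs are translates
  have eF₁ := pairEulerFactor_eq_of_shift (w_shift_zero (S := S) β) hsu₁
  have eLν := pairEulerFactor_eq_of_shift hsuν (w_shift_zero (S := S) one)
  have eF₂ := pairEulerFactor_eq_of_shift hsB (w_shift_zero (S := S) one)
  have pF₁ := partialPairL_eq_of_shift (w_shift_zero (S := S) β) hsu₁
  have pLν := partialPairL_eq_of_shift hsuν (w_shift_zero (S := S) one)
  have pF₂ := partialPairL_eq_of_shift hsB (w_shift_zero (S := S) one)
  have re₁ : ∀ s : ℂ, (s - (0 + (((-t : ℝ)) : ℂ))).re = s.re + t := fun s => by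
    simp only [Complex.sub_re, Complex.add_re, Complex.zero_re, Complex.ofReal_re]; ring
  have reν : ∀ s : ℂ, (s - ((((-(3 * t) : ℝ)) : ℂ) + 0)).re = s.re + 3 * t := fun s => by
    simp only [Complex.sub_re, Complex.add_re, Complex.zero_re, Complex.ofReal_re]; ring
  have re₂ : ∀ s : ℂ, (s - ((((-(2 * t) : ℝ)) : ℂ) + 0)).re = s.re + 2 * t := fun s => by
    simp only [Complex.sub_re, Complex.add_re, Complex.zero_re, Complex.ofReal_re]; ring
  -- (2.1): multipliability of the four Euler products on `Re s > 1`
  have mF₁ : ∀ s : ℂ, 1 < s.re → Multipliable fun v : {v : HeightOneSpectrum (𝓞 F) // v ∉ S} =>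
      ((satakePairPolynomial (β v.1) (su₁ v.1)).eval ((v.1.residueCard : ℂ) ^ (-s)))⁻¹ := by
    intro s hs
    rw [eF₁ s]
    exact hJ1a hS sub₁ hPS hτ₁S huβS hu₁S (s := s - (0 + (((-t : ℝ)) : ℂ))) (by rw [re₁]; linarith)
  have mLν : ∀ s : ℂ, 1 < s.re → Multipliable fun v : {v : HeightOneSpectrum (𝓞 F) // v ∉ S} =>
      ((satakePairPolynomial (suν v.1) (one v.1)).eval ((v.1.residueCard : ℂ) ^ (-s)))⁻¹ := by
    intro s hs
    rw [eLν s]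
    exact hJ1b hS sub₂ hτνS hτ₀S huνS huone (s := s - ((((-(3 * t) : ℝ)) : ℂ) + 0))
      (by rw [reν]; linarith)
  have mZ : ∀ s : ℂ, 1 < s.re → Multipliable fun v : {v : HeightOneSpectrum (𝓞 F) // v ∉ S} =>
      ((satakePairPolynomial (one v.1) (one v.1)).eval ((v.1.residueCard : ℂ) ^ (-s)))⁻¹ :=
    fun s hs => hJ1c hS sub₃ hτ₀S hτ₀S huone huone hs
  have mF₂ : ∀ s : ℂ, 1 < s.re → Multipliable fun v : {v : HeightOneSpectrum (𝓞 F) // v ∉ S} =>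
      ((satakePairPolynomial (sB v.1) (one v.1)).eval ((v.1.residueCard : ℂ) ^ (-s)))⁻¹ := by
    intro s hs
    rw [eF₂ s]
    exact hJ1d hS sub₄ hQS hτ₀S huBS huone (s := s - ((((-(2 * t) : ℝ)) : ℂ) + 0))
      (by rw [re₂]; linarith)
  -- (L-eq) on `Re s > 1`
  have hEq : ∀ᶠ s in 𝓝[{s : ℂ | 1 < s.re}] 1,
      partialPairL S β su₁ s * partialPairL S suν one s =
        partialPairL S one one s * partialPairL S sB one s :=
    eventually_nhdsWithin_of_forall fun s hs =>
      partialPairL_mul_eq_of_satakePairPolynomial_mul_eq (fun v hv => hId v (hTS v hv))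
        (mF₁ s hs) (mLν s hs) (mZ s hs) (mF₂ s hs)
  -- the translation maps along the filter
  have hl : ∀ z : ℂ, Tendsto (fun s : ℂ => s - z) (𝓝[{s : ℂ | 1 < s.re}] 1) (𝓝 (1 - z)) :=
    fun z => ((continuous_id.sub continuous_const).tendsto 1).mono_left nhdsWithin_le_nhds
  -- `A(s + t) → A(1 + t)`
  obtain ⟨hcA, -⟩ := hIa hS sub₅ hPS hτ₁S huβS hu₁S (s := 1 - (0 + (((-t : ℝ)) : ℂ)))
    (by rw [re₁, Complex.one_re]; linarith)
  have hF₁ : Tendsto (partialPairL S β su₁) (𝓝[{s : ℂ | 1 < s.re}] 1)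
      (𝓝 (partialPairL S β u₁ (1 - (0 + (((-t : ℝ)) : ℂ))))) := by
    rw [pF₁]
    exact hcA.tendsto.comp (hl _)
  -- `N(s + 3t) → N(1 + 3t)`
  obtain ⟨hcN, -⟩ := hIb hS sub₆ hτνS hτ₀S huνS huone (s := 1 - ((((-(3 * t) : ℝ)) : ℂ) + 0))
    (by rw [reν, Complex.one_re]; linarith)
  have hLν : Tendsto (partialPairL S suν one) (𝓝[{s : ℂ | 1 < s.re}] 1)
      (𝓝 (partialPairL S uν one (1 - ((((-(3 * t) : ℝ)) : ℂ) + 0)))) := by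
    rw [pLν]
    exact hcN.tendsto.comp (hl _)
  -- the pole of `ζ_F^S(s) = L^S(s, 𝟙 × 𝟙)` at `s = 1` (Hecke): `(s - 1) ζ_F^S(s) → c₀ ≠ 0`
  obtain ⟨c₀, hc₀, hZ⟩ := tendsto_sub_one_mul_partialPairL_one_one hS hone
  -- `C(s + 2t) → C(1 + 2t) ≠ 0`
  obtain ⟨hcC, hC0⟩ := hIc hS sub₇ hQS hτ₀S huBS huone (s := 1 - ((((-(2 * t) : ℝ)) : ℂ) + 0))
    (by rw [re₂, Complex.one_re]; linarith)
  have hF₂ : Tendsto (partialPairL S sB one) (𝓝[{s : ℂ | 1 < s.re}] 1)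
      (𝓝 (partialPairL S B₁ one (1 - ((((-(2 * t) : ℝ)) : ℂ) + 0)))) := by
    rw [pF₂]
    exact hcC.tendsto.comp (hl _)
  exact false_of_pole_times_nonzero_eq_finite (l := 𝓝[{s : ℂ | 1 < s.re}] 1)
    tendsto_sub_one_nhdsWithin_one_lt_re hEq hF₁ hLν hZ hc₀ hF₂ hC0

/-- A Satake family of `π` (choice of a Satake parameter at every unramified place). [folklore] -/
private theorem w_exists_satakeFamily_of {n : ℕ} {h : isCompact_glFiniteIntegralLevel n F}
    (π : AutomorphicRepData (AutomorphyDatum.gl n F h)) :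
    ∃ f : SatakeFamily F, ∀ᶠ w : HeightOneSpectrum (𝓞 F) in cofinite, π.HasSatakeParamAt w (f w) :=
  ⟨fun w => if hw : π.IsUnramifiedAt w then hw.choose else 0, by
    filter_upwards [π.hasSatakeParamAt_cofinite_holds] with w hw
    rw [dif_pos hw]
    exact hw.choose_spec⟩

/-- **No "large" Hecke character among the Satake parameters of a unitary cuspidal datum on
`GL(3)`** (unconditionally).  Let `P` be a cuspidal datum on `GL_3(𝔸_F)` with a
unitary Satake family `β` a.e. (`|det β_w| = 1`), `Pd` a cuspidal datum with the inverse family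
`β_w⁻¹` a.e. (the contragredient), and `θ` a Hecke character with `θ(ϖ_w) ∈ β_w` a.e. and
`|θ| = ‖·‖^{-t}` for some `t > 0` (so `|θ(ϖ_w)| = q_w^{t} > 1`).  Then `False`.  With
`Ω(ϖ_w) = det β_w` (`centralCharacter_satake_of_cuspidal`), `‖·‖^{-t}` (`exists_heckeCharacter_ideleNorm_cpow`)
and the unitary characters `u₁ = θ⁻¹ ‖·‖^{-t}`, `κ₁ = u₁² Ω`, `uν = κ₁ u₁`, the data
`τ₀ = 𝟙`, `τ₁ ↔ u₁`, `τν ↔ uν` (`exists_cuspidal_glOne_hasSatakeParamAt_*`), `P`, `Q = Pd ⊗ κ₁`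
(`CuspidalAutomorphicRepData.exists_twist_hecke_hasSatakeParamAt`) satisfy the shifted (L-eq) of
`false_of_JS_of_eulerIdentity_of_shift` by `satakePairPolynomial_bh_identity`
(`θ⁻¹(ϖ) = q^{-t} u₁(ϖ)`, `ν(ϖ) = q^{-3t} uν(ϖ)`, `κ(ϖ) = q^{-2t} κ₁(ϖ)`).
[cite: BockleHui2025, §3.2.1] -/
theorem false_of_large_heckeCharacter_mem_satake
    {h3 : isCompact_glFiniteIntegralLevel 3 F} (P Pd : CuspidalAutomorphicRepData 3 F h3)
    (β : SatakeFamily F)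
    (hP : ∀ᶠ w : HeightOneSpectrum (𝓞 F) in cofinite, P.1.HasSatakeParamAt w (β w))
    (hPd : ∀ᶠ w : HeightOneSpectrum (𝓞 F) in cofinite, Pd.1.HasSatakeParamAt w ((β w).map (·⁻¹)))
    (huβ : ∀ᶠ w : HeightOneSpectrum (𝓞 F) in cofinite, ‖(β w).prod‖ = 1)
    (θ : HeckeCharacter F)
    (hθ : ∀ᶠ w : HeightOneSpectrum (𝓞 F) in cofinite, θ.valueAtUniformizer w ∈ β w)
    {t : ℝ} (ht : 0 < t)
    (hθt : ∀ x : ideleGroup F, ‖((θ x : ℂˣ) : ℂ)‖ = GaloisRepresentations.ideleNorm x ^ (-t)) :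
    False := by
  have h1 : isCompact_glFiniteIntegralLevel 1 F := isCompact_glFiniteIntegralLevel_holds 1 F
  haveI : NeZero (3 : ℕ) := ⟨by norm_num⟩
  -- the central character of `P` and the norm characters
  obtain ⟨Ω, hΩ⟩ := centralCharacter_satake_of_cuspidal P
  obtain ⟨lam, hlam⟩ := exists_heckeCharacter_ideleNorm_cpow F (((-t : ℝ)) : ℂ)
  -- notation for the local constants `c_w = q_w^{-t}`
  have hc : ∀ w : HeightOneSpectrum (𝓞 F),
      lam.valueAtUniformizer w = ((w.residueCard : ℂ) ^ (((-t : ℝ)) : ℂ))⁻¹ :=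
    HeckeCharacter.valueAtUniformizer_of_cpow hlam
  have hc0 : ∀ w : HeightOneSpectrum (𝓞 F), (w.residueCard : ℂ) ^ (((-t : ℝ)) : ℂ) ≠ 0 :=
    fun w => w_qpow_ne_zero w _
  have hnc : ∀ w : HeightOneSpectrum (𝓞 F),
      ‖(w.residueCard : ℂ) ^ (((-t : ℝ)) : ℂ)‖ = (w.residueCard : ℝ) ^ (-t) := fun w => by
    rw [w_norm_qpow, Complex.ofReal_re]
  have hnθ : ∀ w : HeightOneSpectrum (𝓞 F), ‖θ.valueAtUniformizer w‖ = (w.residueCard : ℝ) ^ t :=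
    fun w => by rw [w_norm_vAU_eq_rpow_neg hθt, neg_neg]
  -- the unitary characters
  set u₁ : HeckeCharacter F := θ⁻¹ * lam with hu₁def
  set κ₁ : HeckeCharacter F := u₁ * u₁ * Ω with hκ₁def
  set uν : HeckeCharacter F := κ₁ * u₁ with huνdef
  have hu₁w : ∀ w, u₁.valueAtUniformizer w =
      (θ.valueAtUniformizer w)⁻¹ * ((w.residueCard : ℂ) ^ (((-t : ℝ)) : ℂ))⁻¹ := fun w => by
    rw [hu₁def, w_vAU_mul, w_vAU_inv, hc]
  have hθinv : ∀ w, (θ.valueAtUniformizer w)⁻¹ =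
      (w.residueCard : ℂ) ^ (((-t : ℝ)) : ℂ) * u₁.valueAtUniformizer w := fun w => by
    rw [hu₁w, mul_comm ((θ.valueAtUniformizer w)⁻¹), ← mul_assoc, mul_inv_cancel₀ (hc0 w), one_mul]
  have hκ₁w : ∀ w, κ₁.valueAtUniformizer w =
      u₁.valueAtUniformizer w * u₁.valueAtUniformizer w * Ω.valueAtUniformizer w := fun w => by
    rw [hκ₁def, w_vAU_mul, w_vAU_mul]
  have huνw : ∀ w, uν.valueAtUniformizer w = κ₁.valueAtUniformizer w * u₁.valueAtUniformizer w :=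
    fun w => by rw [huνdef, w_vAU_mul]
  -- norms at the places: `|u₁(ϖ)| = 1`
  have hnu₁ : ∀ w, ‖u₁.valueAtUniformizer w‖ = 1 := fun w => by
    have hq : (0 : ℝ) < w.residueCard := by exact_mod_cast lt_trans zero_lt_one w.one_lt_residueCard
    rw [hu₁w, norm_mul, norm_inv, norm_inv, hnθ, hnc, Real.rpow_neg hq.le, inv_inv,
      inv_mul_cancel₀ (Real.rpow_pos_of_pos hq t).ne']
  -- the data
  obtain ⟨Q, hQ⟩ := CuspidalAutomorphicRepData.exists_twist_hecke_hasSatakeParamAt κ₁ Pd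
  obtain ⟨τ₀, hτ₀⟩ := exists_cuspidal_glOne_hasSatakeParamAt_one h1
  obtain ⟨τ₁, hτ₁⟩ := exists_cuspidal_glOne_hasSatakeParamAt_valueAtUniformizer h1 u₁
  obtain ⟨τν, hτν⟩ := exists_cuspidal_glOne_hasSatakeParamAt_valueAtUniformizer h1 uν
  -- the good places
  have hgood : ∀ᶠ w : HeightOneSpectrum (𝓞 F) in cofinite,
      P.1.HasSatakeParamAt w (β w) ∧ Ω.valueAtUniformizer w = (β w).prod ∧
      θ.valueAtUniformizer w ∈ β w ∧ ‖(β w).prod‖ = 1 ∧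
      Q.1.HasSatakeParamAt w (((β w).map (·⁻¹)).map (κ₁.valueAtUniformizer w * ·)) ∧
      τ₀.1.HasSatakeParamAt w {1} ∧ τ₁.1.HasSatakeParamAt w {u₁.valueAtUniformizer w} ∧
      τν.1.HasSatakeParamAt w {uν.valueAtUniformizer w} := by
    filter_upwards [hP, hΩ, hθ, huβ, hPd, hQ, hτ₀, hτ₁, hτν]
      with w hw hΩw hθw huw hPdw hQw h0w h1w hνw
    exact ⟨hw, hΩw _ hw, hθw, huw, hQw _ hPdw, h0w, h1w, hνw⟩
  obtain ⟨T, hT, hgoodT⟩ : ∃ T : Set (HeightOneSpectrum (𝓞 F)), T.Finite ∧ ∀ w ∉ T,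
      P.1.HasSatakeParamAt w (β w) ∧ Ω.valueAtUniformizer w = (β w).prod ∧
      θ.valueAtUniformizer w ∈ β w ∧ ‖(β w).prod‖ = 1 ∧
      Q.1.HasSatakeParamAt w (((β w).map (·⁻¹)).map (κ₁.valueAtUniformizer w * ·)) ∧
      τ₀.1.HasSatakeParamAt w {1} ∧ τ₁.1.HasSatakeParamAt w {u₁.valueAtUniformizer w} ∧
      τν.1.HasSatakeParamAt w {uν.valueAtUniformizer w} :=
    ⟨_, Filter.eventually_cofinite.1 hgood, fun w hw => not_not.1 hw⟩
  -- families
  set B₁ : SatakeFamily F := fun w => ((β w).map (·⁻¹)).map (κ₁.valueAtUniformizer w * ·)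
    with hB₁def
  -- pointwise facts at a good place
  have card3 : ∀ w ∉ T, Multiset.card (β w) = 3 := fun w hw => (hgoodT w hw).1.card_eq
  have hβ0 : ∀ w ∉ T, (0 : ℂ) ∉ β w := fun w hw h0 =>
    hasSatakeParamAt_ne_zero_holds (hgoodT w hw).1 0 h0 rfl
  have hnΩ : ∀ w ∉ T, ‖Ω.valueAtUniformizer w‖ = 1 := fun w hw => by
    rw [(hgoodT w hw).2.1]; exact (hgoodT w hw).2.2.2.1
  have hnκ₁ : ∀ w ∉ T, ‖κ₁.valueAtUniformizer w‖ = 1 := fun w hw => by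
    rw [hκ₁w, norm_mul, norm_mul, hnu₁, hnΩ w hw, one_mul, one_mul]
  have hnuν : ∀ w ∉ T, ‖uν.valueAtUniformizer w‖ = 1 := fun w hw => by
    rw [huνw, norm_mul, hnκ₁ w hw, hnu₁, one_mul]
  have hnB : ∀ w ∉ T, ‖(B₁ w).prod‖ = 1 := fun w hw => by
    show ‖(((β w).map (·⁻¹)).map (κ₁.valueAtUniformizer w * ·)).prod‖ = 1
    rw [prod_map_const_mul_eq, Multiset.prod_map_inv, Multiset.card_map, norm_mul, norm_pow, norm_inv,
      hnκ₁ w hw, Multiset.map_id', (hgoodT w hw).2.2.2.1, one_pow, inv_one, one_mul]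
  -- powers of the local constant
  have hc2 : ∀ w : HeightOneSpectrum (𝓞 F),
      (w.residueCard : ℂ) ^ (((-(2 * t) : ℝ)) : ℂ) = ((w.residueCard : ℂ) ^ (((-t : ℝ)) : ℂ)) ^ 2 :=
    fun w => by
    rw [← Complex.cpow_nat_mul]; congr 1; push_cast; ring
  have hc3 : ∀ w : HeightOneSpectrum (𝓞 F),
      (w.residueCard : ℂ) ^ (((-(3 * t) : ℝ)) : ℂ) = ((w.residueCard : ℂ) ^ (((-t : ℝ)) : ℂ)) ^ 3 :=
    fun w => by
    rw [← Complex.cpow_nat_mul]; congr 1; push_cast; ring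
  -- the Euler-factor identity at a good place
  have hId : ∀ w ∉ T,
      satakePairPolynomial (β w)
            (({u₁.valueAtUniformizer w} : Multiset ℂ).map
              (((w.residueCard : ℂ) ^ (((-t : ℝ)) : ℂ)) * ·)) *
          satakePairPolynomial
            (({uν.valueAtUniformizer w} : Multiset ℂ).map
              (((w.residueCard : ℂ) ^ (((-(3 * t) : ℝ)) : ℂ)) * ·)) {1} =
        satakePairPolynomial {1} {1} *
          satakePairPolynomial ((B₁ w).map (((w.residueCard : ℂ) ^ (((-(2 * t) : ℝ)) : ℂ)) * ·))
            {1} := by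
    intro w hw
    obtain ⟨γ, hγ⟩ := Multiset.exists_cons_of_mem (hgoodT w hw).2.2.1
    have hcardγ : Multiset.card γ = 2 := by
      have h3c := card3 w hw
      rw [hγ, Multiset.card_cons] at h3c
      omega
    obtain ⟨b, c, rfl⟩ := Multiset.card_eq_two.1 hcardγ
    have hθ0 : θ.valueAtUniformizer w ≠ 0 := w_vAU_ne_zero θ w
    have hC0 : (w.residueCard : ℂ) ^ (((-t : ℝ)) : ℂ) ≠ 0 := hc0 w
    have hb : b ≠ 0 := fun h => hβ0 w hw (by rw [hγ, h]; simp)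
    have hcc : c ≠ 0 := fun h => hβ0 w hw (by rw [hγ, h]; simp)
    have hprodγ : (β w).prod = θ.valueAtUniformizer w * (b * c) := by
      rw [hγ, Multiset.prod_cons, Multiset.insert_eq_cons, Multiset.prod_cons, Multiset.prod_singleton]
    -- `q^{-t} u₁(ϖ) = θ(ϖ)⁻¹`
    have e1 : ({u₁.valueAtUniformizer w} : Multiset ℂ).map
        (((w.residueCard : ℂ) ^ (((-t : ℝ)) : ℂ)) * ·) = {(θ.valueAtUniformizer w)⁻¹} := by
      rw [Multiset.map_singleton, ← hθinv]
    -- `q^{-2t} κ₁(ϖ) = θ(ϖ)⁻¹ (b c)` (the twist `κ` of the contragredient)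
    have e2 : (w.residueCard : ℂ) ^ (((-(2 * t) : ℝ)) : ℂ) * κ₁.valueAtUniformizer w =
        (θ.valueAtUniformizer w)⁻¹ * (b * c) := by
      rw [hc2, hκ₁w, (hgoodT w hw).2.1, hprodγ, hu₁w]
      field_simp
    -- `q^{-3t} uν(ϖ) = θ(ϖ)⁻¹ (b c) θ(ϖ)⁻¹` (the character `ν`)
    have e3 : ({uν.valueAtUniformizer w} : Multiset ℂ).map
        (((w.residueCard : ℂ) ^ (((-(3 * t) : ℝ)) : ℂ)) * ·) =
          {(θ.valueAtUniformizer w)⁻¹ * (b * c) * (θ.valueAtUniformizer w)⁻¹} := by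
      rw [Multiset.map_singleton]
      congr 1
      rw [hc3, huνw, hκ₁w, (hgoodT w hw).2.1, hprodγ, hu₁w]
      field_simp
    have e4 : (B₁ w).map (((w.residueCard : ℂ) ^ (((-(2 * t) : ℝ)) : ℂ)) * ·) =
        ((β w).map (·⁻¹)).map ((θ.valueAtUniformizer w)⁻¹ * (b * c) * ·) := by
      show (((β w).map (·⁻¹)).map (κ₁.valueAtUniformizer w * ·)).map _ = _
      rw [Multiset.map_map]
      refine Multiset.map_congr rfl fun x _ => ?_
      show (w.residueCard : ℂ) ^ (((-(2 * t) : ℝ)) : ℂ) * (κ₁.valueAtUniformizer w * x) = _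
      rw [← mul_assoc, e2]
    rw [e1, e3, e4, hγ]
    exact satakePairPolynomial_bh_identity hθ0 hb hcc
  -- conclude
  exact false_of_JS_of_eulerIdentity_of_shift τ₀ τ₁ τν P Q (fun _ => {1})
    (fun w => {u₁.valueAtUniformizer w}) (fun w => {uν.valueAtUniformizer w}) β B₁ hT (fun _ => rfl)
    (fun w hw => (hgoodT w hw).2.2.2.2.2.1) (fun w hw => (hgoodT w hw).2.2.2.2.2.2.1)
    (fun w hw => (hgoodT w hw).2.2.2.2.2.2.2) (fun w hw => (hgoodT w hw).1)
    (fun w hw => (hgoodT w hw).2.2.2.2.1)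
    (fun w _ => by rw [Multiset.prod_singleton, hnu₁])
    (fun w hw => by rw [Multiset.prod_singleton, hnuν w hw])
    (fun w hw => (hgoodT w hw).2.2.2.1) hnB ht hId

end OffAxis

/-! ### The weight condition `hpin`, proved -/

section Weight

variable {F : Type} [Field F] [NumberField F]

/-- **The weight condition of BH §3.2.1 (`hpin` of `isIrreducible_galoisRep_gl3_totallyReal_of_JS`),
proved.**  Granting the contragredient datum on `GL(3)`: if `π` is a
cuspidal datum on `GL_3(𝔸_F)` and `μ` a Hecke character with `μ(ϖ_v) ∈ t_{π,v}` at almost every `v`,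
then `‖∏ t_{π,v}‖ = ‖μ(ϖ_v)‖³` at almost every `v`.  Proof: `|ω_π| = ‖·‖^{σ_Ω}` (central character
at Satake level, `centralCharacter_satake_of_cuspidal`; `exists_norm_apply_eq_ideleNorm_rpow`) and
`|μ| = ‖·‖^{σ_μ}`, so `‖∏ t_{π,v}‖ = q_v^{-σ_Ω}`, `‖μ(ϖ_v)‖ = q_v^{-σ_μ}`, and it suffices that
`σ_Ω = 3 σ_μ`.  Otherwise normalise `π₀ = π ⊗ ‖·‖^{-σ_Ω/3}` (unitary Satake family
`β = q^{σ_Ω/3} t_π`), `θ = ‖·‖^{-σ_Ω/3} μ` (`θ(ϖ_v) ∈ β_v`, `|θ| = ‖·‖^{d}`, `d = σ_μ - σ_Ω/3 ≠ 0`), and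
let `π₀^∨` be the contragredient datum: for `d < 0`, `false_of_large_heckeCharacter_mem_satake`
applies to `(π₀, π₀^∨, θ)`; for `d > 0`, to `(π₀^∨, π₀, θ⁻¹)`.
[cite: BockleHui2025, §3.2.1] -/
theorem norm_prod_satake_eq_norm_cube_of_JS
    {h3 : isCompact_glFiniteIntegralLevel 3 F}
    (hC : CuspidalAutomorphicRepData.exists_contragredient_satake h3)
    (π : CuspidalAutomorphicRepData 3 F h3) {μ : HeckeCharacter F}
    (hμ : ∀ᶠ v : HeightOneSpectrum (𝓞 F) in cofinite, ∀ α : Multiset ℂ,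
      π.1.HasSatakeParamAt v α → μ.valueAtUniformizer v ∈ α) :
    ∀ᶠ v : HeightOneSpectrum (𝓞 F) in cofinite, ∀ α : Multiset ℂ,
      π.1.HasSatakeParamAt v α → ‖α.prod‖ = ‖μ.valueAtUniformizer v‖ ^ 3 := by
  haveI : NeZero (3 : ℕ) := ⟨by norm_num⟩
  obtain ⟨Ω, hΩ⟩ := centralCharacter_satake_of_cuspidal π
  obtain ⟨σΩ, hσΩ⟩ := Ω.exists_norm_apply_eq_ideleNorm_rpow
  obtain ⟨σμ, hσμ⟩ := μ.exists_norm_apply_eq_ideleNorm_rpow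
  have hnΩ : ∀ w, ‖Ω.valueAtUniformizer w‖ = (w.residueCard : ℝ) ^ (-σΩ) := w_norm_vAU_eq_rpow_neg hσΩ
  have hnμ : ∀ w, ‖μ.valueAtUniformizer w‖ = (w.residueCard : ℝ) ^ (-σμ) := w_norm_vAU_eq_rpow_neg hσμ
  by_cases hd : σΩ = 3 * σμ
  · filter_upwards [hΩ] with v hΩv α hα
    have hq : (0 : ℝ) ≤ v.residueCard := Nat.cast_nonneg _
    rw [← hΩv α hα, hnΩ, hnμ, hd, ← Real.rpow_natCast, ← Real.rpow_mul hq]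
    congr 1
    push_cast
    ring
  · exfalso
    -- the unitary normalisation `P = π ⊗ ‖·‖^{-σΩ/3}` and `θ = ‖·‖^{-σΩ/3} μ`
    obtain ⟨lam, hlam⟩ := exists_heckeCharacter_ideleNorm_cpow F (((-(σΩ / 3)) : ℝ) : ℂ)
    have hnlam : ∀ x : ideleGroup F,
        ‖((lam x : ℂˣ) : ℂ)‖ = GaloisRepresentations.ideleNorm x ^ (-(σΩ / 3)) := fun x => by
      rw [hlam x,
        Complex.norm_cpow_eq_rpow_re_of_pos (GaloisRepresentations.HeckeCharacter.ideleNorm_pos' F x),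
        Complex.ofReal_re]
    have hnlamw : ∀ w, ‖lam.valueAtUniformizer w‖ = (w.residueCard : ℝ) ^ (σΩ / 3) := fun w => by
      rw [w_norm_vAU_eq_rpow_neg hnlam, neg_neg]
    obtain ⟨P, hP⟩ := CuspidalAutomorphicRepData.exists_twist_hecke_hasSatakeParamAt lam π
    obtain ⟨Pd, hPd⟩ := hC P
    obtain ⟨απ, eπ⟩ := w_exists_satakeFamily_of π.1
    set β : SatakeFamily F := fun w => (απ w).map (lam.valueAtUniformizer w * ·) with hβdef
    set θ : HeckeCharacter F := lam * μ with hθdef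
    have hPβ : ∀ᶠ w : HeightOneSpectrum (𝓞 F) in cofinite, P.1.HasSatakeParamAt w (β w) := by
      filter_upwards [eπ, hP] with w hw hPw
      exact hPw _ hw
    have hPdβ : ∀ᶠ w : HeightOneSpectrum (𝓞 F) in cofinite,
        Pd.1.HasSatakeParamAt w ((β w).map (·⁻¹)) :=
      hPβ.mono fun w hw => hPd w _ hw
    have huβ : ∀ᶠ w : HeightOneSpectrum (𝓞 F) in cofinite, ‖(β w).prod‖ = 1 := by
      filter_upwards [eπ, hΩ] with w hw hΩw
      have hq : (0 : ℝ) < w.residueCard := by exact_mod_cast lt_trans zero_lt_one w.one_lt_residueCard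
      show ‖((απ w).map (lam.valueAtUniformizer w * ·)).prod‖ = 1
      rw [prod_map_const_mul_eq, hw.card_eq, ← hΩw _ hw, norm_mul, norm_pow, hnlamw, hnΩ,
        ← Real.rpow_natCast, ← Real.rpow_mul hq.le, ← Real.rpow_add hq,
        show σΩ / 3 * ((3 : ℕ) : ℝ) + -σΩ = 0 by push_cast; ring, Real.rpow_zero]
    have hθβ : ∀ᶠ w : HeightOneSpectrum (𝓞 F) in cofinite, θ.valueAtUniformizer w ∈ β w := by
      filter_upwards [eπ, hμ] with w hw hμw
      show θ.valueAtUniformizer w ∈ (απ w).map (lam.valueAtUniformizer w * ·)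
      rw [hθdef, w_vAU_mul]
      exact Multiset.mem_map_of_mem _ (hμw _ hw)
    have hnθ : ∀ x : ideleGroup F,
        ‖((θ x : ℂˣ) : ℂ)‖ = GaloisRepresentations.ideleNorm x ^ (σμ - σΩ / 3) := fun x => by
      rw [hθdef, GaloisRepresentations.HeckeCharacter.mul_apply, Units.val_mul, norm_mul, hnlam x,
        hσμ x, ← Real.rpow_add (GaloisRepresentations.HeckeCharacter.ideleNorm_pos' F x)]
      congr 1
      ring
    rcases lt_or_gt_of_ne (show σμ - σΩ / 3 ≠ 0 by intro h; exact hd (by linarith)) with hlt | hgt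
    · -- `d < 0`: `|θ(ϖ)| = q^{-d} > 1`
      refine false_of_large_heckeCharacter_mem_satake P Pd β hPβ hPdβ huβ θ hθβ
        (t := -(σμ - σΩ / 3)) (by linarith) fun x => ?_
      rw [hnθ x, neg_neg]
    · -- `d > 0`: pass to the dual data `(Pd, P, β⁻¹, θ⁻¹)`
      refine false_of_large_heckeCharacter_mem_satake Pd P (fun w => (β w).map (·⁻¹)) hPdβ
        (hPβ.mono fun w hw => by rwa [satakeParam_inv_inv])
        (huβ.mono fun w hw => by
          rw [Multiset.prod_map_inv, Multiset.map_id', norm_inv, hw, inv_one]) θ⁻¹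
        (hθβ.mono fun w hw => by rw [w_vAU_inv]; exact Multiset.mem_map_of_mem _ hw)
        (t := σμ - σΩ / 3) hgt fun x => ?_
      rw [GaloisRepresentations.HeckeCharacter.inv_apply, Units.val_inv_eq_inv_val, norm_inv, hnθ x,
        Real.rpow_neg (GaloisRepresentations.HeckeCharacter.ideleNorm_pos' F x).le]

/-- **The analytic case `hB` of BH §3.2.1 without the weight hypothesis.**  Granting Jacquet–Shalika
(2.2) for Borel–Jacquet data and the contragredient datum on `GL(3)` ((2.1), the pole of `ζ_F^S` and
the central character being theorems): for a cuspidal `π` on `GL_3(𝔸_F)` and a Hecke character `μ`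
with `μ(ϖ_v) ∈ t_{π,v}` a.e., `∏ t_{π,v} = μ(ϖ_v)³` a.e. — `prod_satake_eq_cube_of_JS` with
`hΩ := centralCharacter_satake_of_cuspidal`, `hpin := norm_prod_satake_eq_norm_cube_of_JS`.
[cite: BockleHui2025, §3.2.1] [cite: ArthurClozelAMS120, Ch. 3 §2 (2.2)] -/
theorem prod_satake_eq_cube_of_JS'
    (hJ2 : JacquetShalika1981_partialPairL_boundary_repData)
    {h3 : isCompact_glFiniteIntegralLevel 3 F}
    (hC : CuspidalAutomorphicRepData.exists_contragredient_satake h3)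
    (π : CuspidalAutomorphicRepData 3 F h3) {μ : HeckeCharacter F}
    (hμ : ∀ᶠ v : HeightOneSpectrum (𝓞 F) in cofinite, ∀ α : Multiset ℂ,
      π.1.HasSatakeParamAt v α → μ.valueAtUniformizer v ∈ α) :
    ∀ᶠ v : HeightOneSpectrum (𝓞 F) in cofinite, ∀ α : Multiset ℂ,
      π.1.HasSatakeParamAt v α → α.prod = μ.valueAtUniformizer v ^ 3 := by
  haveI : NeZero (3 : ℕ) := ⟨by norm_num⟩
  obtain ⟨Ω, hΩ⟩ := centralCharacter_satake_of_cuspidal π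
  exact prod_satake_eq_cube_of_JS hJ2 hC π hΩ hμ (norm_prod_satake_eq_norm_cube_of_JS hC π hμ)

end Weight

/-! ### Assembly -/

section Assembly

/-- **`hB` of `lDichotomy_gl3_totallyReal_of_satakeLevel` from Jacquet–Shalika (2.2) and the
contragredient alone** (the hypotheses `hcent`, `hpin` of `satakeLevel_analyticCase_of_JS` being
discharged in this file). [cite: BockleHui2025, §3.2.1] -/
theorem satakeLevel_analyticCase_of_JS'
    (hJ2 : JacquetShalika1981_partialPairL_boundary_repData)
    (hC : ∀ (K : Type) [Field K] [NumberField K] (hcpt : isCompact_glFiniteIntegralLevel 3 K),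
      CuspidalAutomorphicRepData.exists_contragredient_satake hcpt) :
    ∀ (K : Type) [Field K] [NumberField K], IsTotallyReal K →
      ∀ (hcpt : isCompact_glFiniteIntegralLevel 3 K) (π : CuspidalAutomorphicRepData 3 K hcpt),
        π.1.IsRegularAlgebraic → ∀ μ : HeckeCharacter K, μ.IsAlgebraic →
        (∀ᶠ v : HeightOneSpectrum (𝓞 K) in cofinite, μ.IsUnramifiedAt v ∧
          ∀ α : Multiset ℂ, π.1.HasSatakeParamAt v α → μ.valueAtUniformizer v ∈ α) →
        ∀ᶠ v : HeightOneSpectrum (𝓞 K) in cofinite,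
          ∀ α : Multiset ℂ, π.1.HasSatakeParamAt v α → α.prod = μ.valueAtUniformizer v ^ 3 := by
  intro K _ _ _ hcpt π _ μ _ hμ
  exact prod_satake_eq_cube_of_JS' hJ2 (hC K hcpt) π (hμ.mono fun v hv => hv.2)

/-- **Böckle–Hui, Theorem 1.2, from named facts of the tree and two printed inputs.**  What now
separates `isIrreducible_galoisRep_gl3_totallyReal_holds` from the tree:
* named facts, unproved: Böckle–Hui Thm. 1.1 (`exists_heckeCharacter_of_weaklyDivides`),
  Jacquet–Shalika (2.2) for Borel–Jacquet data (`JacquetShalika1981_partialPairL_boundary_repData`;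
  reduced in the tree to its `L²` leaves, see `isIrreducible_galoisRep_gl3_totallyReal_of_L2_leaves`)
  and the contragredient datum
  (`CuspidalAutomorphicRepData.exists_contragredient_satake`);
* printed inputs with no carrier in the tree: C-arithmeticity of `π` (`hCar`, Clozel 3.13 + BG14) and
  [Hu23a] (`hHui`: essential self-duality forces irreducibility for `n = 3`, `K` totally real).
The weight condition and the central character of `isIrreducible_galoisRep_gl3_totallyReal_of_JS` are
discharged (`satakeLevel_analyticCase_of_JS'`).
[cite: BockleHui2025, Theorem 1.2, §3.1 and §3.2.1] -/
theorem isIrreducible_galoisRep_gl3_totallyReal_of_JS'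
    (hBH : GaloisRepresentations.exists_heckeCharacter_of_weaklyDivides)
    (hCar : ∀ {K : Type} [Field K] [NumberField K] (hcpt : isCompact_glFiniteIntegralLevel 3 K),
      IsTotallyReal K → ∀ (π : CuspidalAutomorphicRepData 3 K hcpt), π.1.IsRegularAlgebraic →
      ∃ E : Subfield ℂ, FiniteDimensional ℚ E ∧
        ∀ᶠ v : HeightOneSpectrum (𝓞 K) in cofinite, ∀ α : Multiset ℂ,
          π.1.HasSatakeParamAt v α → ∀ i ≤ 3, heckeEigenvalueOf 3 v α i ∈ E)
    (hJ2 : JacquetShalika1981_partialPairL_boundary_repData)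
    (hC : ∀ (K : Type) [Field K] [NumberField K] (hcpt : isCompact_glFiniteIntegralLevel 3 K),
      CuspidalAutomorphicRepData.exists_contragredient_satake hcpt)
    (hHui : ∀ (K : Type) [Field K] [NumberField K], IsTotallyReal K →
      ∀ (hcpt : isCompact_glFiniteIntegralLevel 3 K) (π : CuspidalAutomorphicRepData 3 K hcpt),
        π.1.IsRegularAlgebraic →
        (∃ η : HeckeCharacter K, ∀ᶠ v : HeightOneSpectrum (𝓞 K) in cofinite,
          ∀ α : Multiset ℂ, π.1.HasSatakeParamAt v α →
            η.IsUnramifiedAt v ∧ α.map (fun a => a⁻¹) = α.map (fun a => η.valueAtUniformizer v * a)) →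
        ∀ (ℓ : ℕ) [Fact ℓ.Prime] (ι : PadicAlgCl ℓ ≃+* ℂ)
        (r : GaloisRepresentations.FramedGaloisRep K (PadicAlgCl ℓ) 3), r.toGaloisRep.IsSemisimple →
        (∀ (v : HeightOneSpectrum (𝓞 K)) (α : Multiset ℂ), π.1.HasSatakeParamAt v α →
            ((ℓ : ℕ) : 𝓞 K) ∉ v.asIdeal →
              r.IsUnramifiedAt v ∧ r.HasFrobCharpolyAt v (arithFrobPolyOfSatake ι v.residueCard 3 α)) →
        r.toGaloisRep.IsIrreducible) :
    isIrreducible_galoisRep_gl3_totallyReal :=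
  isIrreducible_galoisRep_gl3_totallyReal_of_weaklyDivides_of_arithmetic_of_satakeLevel_of_hui hBH
    hCar (satakeLevel_analyticCase_of_JS' hJ2 hC) hHui

/-- **Böckle–Hui, Theorem 1.2, with the Jacquet–Shalika input taken at its `L²` leaves.**  Same as
`isIrreducible_galoisRep_gl3_totallyReal_of_JS'`, with (2.2) for Borel–Jacquet data supplied from the
`L²` facts `JacquetShalika1981_partialPairL_at_one_of_ne_conj`, `…_boundary_of_ne_one`,
`…_at_one_of_rank_ne` and `multiplicity_one_gl`
(`JacquetShalika1981_partialPairL_boundary_repData_of_L2_leaves`).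
[cite: BockleHui2025, Theorem 1.2] [cite: ArthurClozelAMS120, Ch. 3 §2 (2.2)] -/
theorem isIrreducible_galoisRep_gl3_totallyReal_of_L2_leaves
    (hBH : GaloisRepresentations.exists_heckeCharacter_of_weaklyDivides)
    (hCar : ∀ {K : Type} [Field K] [NumberField K] (hcpt : isCompact_glFiniteIntegralLevel 3 K),
      IsTotallyReal K → ∀ (π : CuspidalAutomorphicRepData 3 K hcpt), π.1.IsRegularAlgebraic →
      ∃ E : Subfield ℂ, FiniteDimensional ℚ E ∧
        ∀ᶠ v : HeightOneSpectrum (𝓞 K) in cofinite, ∀ α : Multiset ℂ,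
          π.1.HasSatakeParamAt v α → ∀ i ≤ 3, heckeEigenvalueOf 3 v α i ∈ E)
    (h22 : ∀ {n : ℕ} {K : Type} [Field K] [NumberField K] {μ : Measure (gl n K).automorphicQuotient}
      [(gl n K).IsAutomorphicMeasure μ],
      JacquetShalika1981_partialPairL_at_one_of_ne_conj (n := n) (K := K) (μ := μ))
    (h22' : ∀ {n m : ℕ} {K : Type} [Field K] [NumberField K]
      {μ : Measure (gl n K).automorphicQuotient} [(gl n K).IsAutomorphicMeasure μ]
      {μ' : Measure (gl m K).automorphicQuotient} [(gl m K).IsAutomorphicMeasure μ'],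
      JacquetShalika1981_partialPairL_boundary_of_ne_one (n := n) (m := m) (K := K) (μ := μ)
        (μ' := μ'))
    (hrk : ∀ {n m : ℕ} {K : Type} [Field K] [NumberField K]
      {μ : Measure (gl n K).automorphicQuotient} [(gl n K).IsAutomorphicMeasure μ]
      {μ' : Measure (gl m K).automorphicQuotient} [(gl m K).IsAutomorphicMeasure μ'],
      JacquetShalika1981_partialPairL_at_one_of_rank_ne (n := n) (m := m) (K := K) (μ := μ)
        (μ' := μ'))
    (hm1 : ∀ (n : ℕ) (K : Type) [Field K] [NumberField K] (μ : Measure (gl n K).automorphicQuotient)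
      [(gl n K).IsAutomorphicMeasure μ], multiplicity_one_gl n K μ)
    (hC : ∀ (K : Type) [Field K] [NumberField K] (hcpt : isCompact_glFiniteIntegralLevel 3 K),
      CuspidalAutomorphicRepData.exists_contragredient_satake hcpt)
    (hHui : ∀ (K : Type) [Field K] [NumberField K], IsTotallyReal K →
      ∀ (hcpt : isCompact_glFiniteIntegralLevel 3 K) (π : CuspidalAutomorphicRepData 3 K hcpt),
        π.1.IsRegularAlgebraic →
        (∃ η : HeckeCharacter K, ∀ᶠ v : HeightOneSpectrum (𝓞 K) in cofinite,
          ∀ α : Multiset ℂ, π.1.HasSatakeParamAt v α →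
            η.IsUnramifiedAt v ∧ α.map (fun a => a⁻¹) = α.map (fun a => η.valueAtUniformizer v * a)) →
        ∀ (ℓ : ℕ) [Fact ℓ.Prime] (ι : PadicAlgCl ℓ ≃+* ℂ)
        (r : GaloisRepresentations.FramedGaloisRep K (PadicAlgCl ℓ) 3), r.toGaloisRep.IsSemisimple →
        (∀ (v : HeightOneSpectrum (𝓞 K)) (α : Multiset ℂ), π.1.HasSatakeParamAt v α →
            ((ℓ : ℕ) : 𝓞 K) ∉ v.asIdeal →
              r.IsUnramifiedAt v ∧ r.HasFrobCharpolyAt v (arithFrobPolyOfSatake ι v.residueCard 3 α)) →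
        r.toGaloisRep.IsIrreducible) :
    isIrreducible_galoisRep_gl3_totallyReal :=
  isIrreducible_galoisRep_gl3_totallyReal_of_JS' hBH hCar
    (JacquetShalika1981_partialPairL_boundary_repData_of_L2_leaves h22 h22' hrk hm1) hC hHui

end Assembly

end Literature.NumberTheory.Automorphic
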